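import Mathlib
import Summits.Ventures.PercRepro2.SwOutSevSw

/-!
# An instance of Theorem A_sev: a junction with a pure arm and a mixed arm (blind cell
PercRepro2, night-4 g22, 2026-08-27; proofs/NIGHT4-G22.md §3)

The graph `sevEx` on `Fin 8` (`l = 0`, `h = 1`, `o = 2`, the junction `u = 3`, the PURE dropped
vertex `p₁ = 4`, the MIXED dropped vertex `p₂ = 5` with its h-piece `y = 6`, the u-arm `x = 7`)
with the eleven edges `hx, ux, up₁, up₂, p₂y, hy, xl, p₁l, p₂l, yl, ol`.  The simple-arm
hypothesis (H1) of Theorem A fails at `p₂` (not joined to `h`, its component `{p₂, y}` meets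
`N(h)`), and the mixed single junction of Theorem A_mix fails at `p₁` (a neighbour of `u` neither
adjacent to `h` nor the dropped vertex): no earlier junction theorem of the tree applies;
**row (SW) holds** (`sw_sevEx`) by `sw_of_mixedJunctionR`.
-/

namespace Summit.Ventures.PercRepro2

namespace MixedArms

open Hull LocRows BigBlock

open scoped Classical

/-- The junction with a pure arm and a mixed arm: `l = 0`, `h = 1`, `o = 2`, `u = 3`, `p₁ = 4`,
`p₂ = 5`, `y = 6`, `x = 7`. -/
def sevEx : Fin 11 → Sym2 (Fin 8)
  | 0 => s(1, 7) | 1 => s(3, 7) | 2 => s(3, 4) | 3 => s(3, 5) | 4 => s(5, 6) | 5 => s(1, 6)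
  | 6 => s(7, 0) | 7 => s(4, 0) | 8 => s(5, 0) | 9 => s(6, 0) | 10 => s(2, 0)

/-- The two dropped vertices. -/
def sevExP : Fin 2 → Fin 8 := ![4, 5]

/-- An edge with no end at `c` is not an edge at `c`. -/
lemma no_edge_at' {a b c x : Fin 8} (h : s(a, b) = s(c, x)) (ha : a ≠ c) (hb : b ≠ c) : False := by
  rw [Sym2.eq_iff] at h
  rcases h with ⟨h1, _⟩ | ⟨_, h2⟩
  · exact ha h1
  · exact hb h2

/-- The other end of an edge at `a`. -/
lemma eq_of_edge' {a b x : Fin 8} (h : s(a, b) = s(a, x)) (hab : b ≠ a) : x = b := by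
  rw [Sym2.eq_iff] at h
  rcases h with ⟨_, h2⟩ | ⟨h1, h2⟩
  · exact h2.symm
  · exact absurd h2 hab

/-- The component of `p₁ = 4` in `G[{0}ᶜ ∖ {1, 3}]` is `{4}`. -/
lemma sevEx_compU_p1 : compU sevEx ({0}ᶜ) 1 3 4 ⊆ {4} := by
  intro v hv
  unfold compU at hv
  rw [mem_cluster] at hv
  refine mem_of_conn_of_closed (S := {4}) ?_ (by simp) hv
  intro a ha b hab
  obtain ⟨_, e, he, hends⟩ := openGraph_adj.1 hab
  simp only [decide_eq_true_eq] at he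
  obtain ⟨x, hx, y, hy, hxy⟩ := he
  simp only [Set.mem_sdiff, Set.mem_compl_iff, Set.mem_singleton_iff, Set.mem_insert_iff,
    not_or] at hx hy
  simp only [Set.mem_singleton_iff] at ha ⊢
  fin_cases e <;> simp only [sevEx] at hxy hends <;> rw [Sym2.eq_iff] at hxy hends <;>
    rcases hxy with ⟨rfl, rfl⟩ | ⟨rfl, rfl⟩ <;> rcases hends with ⟨rfl, rfl⟩ | ⟨rfl, rfl⟩ <;>
    simp_all

/-- The component of `p₂ = 5` in `G[{0}ᶜ ∖ {1, 3}]` is `{5, 6}`. -/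
lemma sevEx_compU_p2 : compU sevEx ({0}ᶜ) 1 3 5 ⊆ {5, 6} := by
  intro v hv
  unfold compU at hv
  rw [mem_cluster] at hv
  refine mem_of_conn_of_closed (S := {5, 6}) ?_ (by simp) hv
  intro a ha b hab
  obtain ⟨_, e, he, hends⟩ := openGraph_adj.1 hab
  simp only [decide_eq_true_eq] at he
  obtain ⟨x, hx, y, hy, hxy⟩ := he
  simp only [Set.mem_sdiff, Set.mem_compl_iff, Set.mem_singleton_iff, Set.mem_insert_iff,
    not_or] at hx hy
  simp only [Set.mem_insert_iff, Set.mem_singleton_iff] at ha ⊢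
  fin_cases e <;> simp only [sevEx] at hxy hends <;> rw [Sym2.eq_iff] at hxy hends <;>
    rcases hxy with ⟨rfl, rfl⟩ | ⟨rfl, rfl⟩ <;> rcases hends with ⟨rfl, rfl⟩ | ⟨rfl, rfl⟩ <;>
    simp_all

/-- The several-arms junction of `sevEx`. -/
theorem sevEx_junction : MixedJunctionR sevEx ({0}ᶜ) 1 3 sevExP 2 where
  hne_hu := by decide
  hne_hp := by decide
  hne_up := by decide
  p_inj := by decide
  hou := by decide
  hop := by decide
  hloop_h := by intro e; fin_cases e <;> decide
  hloop_u := by intro e; fin_cases e <;> decide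
  hloop_p := by intro r e; fin_cases r <;> fin_cases e <;> decide
  hnadj := by intro e; fin_cases e <;> decide
  hnadj_p := by intro r e; fin_cases r <;> fin_cases e <;> decide
  hup := by
    intro r
    fin_cases r
    · exact ⟨2, rfl⟩
    · exact ⟨3, rfl⟩
  hu_adj_h := by
    intro e x he hx
    fin_cases e <;> simp only [sevEx] at he
    · exact (no_edge_at' he (by decide) (by decide)).elim
    · obtain rfl := eq_of_edge' he (by decide)
      exact ⟨0, by decide⟩
    · obtain rfl := eq_of_edge' he (by decide)
      exact absurd rfl (hx 0)
    · obtain rfl := eq_of_edge' he (by decide)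
      exact absurd rfl (hx 1)
    all_goals exact (no_edge_at' he (by decide) (by decide)).elim
  hp_adj_h := by
    intro r e x he hxU hxu
    fin_cases r <;> simp only [sevExP] at he
    · fin_cases e <;> simp only [sevEx] at he
      · exact (no_edge_at' he (by decide) (by decide)).elim
      · exact (no_edge_at' he (by decide) (by decide)).elim
      · rw [Sym2.eq_swap] at he
        obtain rfl := eq_of_edge' he (by decide)
        exact absurd rfl hxu
      all_goals first
        | exact (no_edge_at' he (by decide) (by decide)).elim
        | (obtain rfl := eq_of_edge' he (by decide); exact absurd hxU (by simp))
    · fin_cases e <;> simp only [sevEx] at he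
      · exact (no_edge_at' he (by decide) (by decide)).elim
      · exact (no_edge_at' he (by decide) (by decide)).elim
      · exact (no_edge_at' he (by decide) (by decide)).elim
      · rw [Sym2.eq_swap] at he
        obtain rfl := eq_of_edge' he (by decide)
        exact absurd rfl hxu
      · obtain rfl := eq_of_edge' he (by decide)
        exact ⟨5, by decide⟩
      all_goals first
        | exact (no_edge_at' he (by decide) (by decide)).elim
        | (obtain rfl := eq_of_edge' he (by decide); exact absurd hxU (by simp))
  hcomp := by
    intro r x hx hxp e he
    fin_cases r <;> simp only [sevExP] at hx hxp
    · have := sevEx_compU_p1 hx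
      simp only [Set.mem_singleton_iff] at this
      exact hxp this
    · have := sevEx_compU_p2 hx
      simp only [Set.mem_insert_iff, Set.mem_singleton_iff] at this
      rcases this with rfl | rfl
      · exact hxp rfl
      · revert he; fin_cases e <;> decide
  hout := by
    intro x hx hx1 hx2 hx3
    simp only [Set.mem_compl_iff, Set.mem_singleton_iff] at hx
    fin_cases x
    · exact absurd rfl hx
    · exact absurd rfl hx1
    · exact absurd rfl hx2
    · exact absurd rfl hx3
    · exact Or.inl ⟨7, 0, rfl, by simp⟩
    · exact Or.inl ⟨8, 0, rfl, by simp⟩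
    · exact Or.inl ⟨9, 0, rfl, by simp⟩
    · exact Or.inl ⟨6, 0, rfl, by simp⟩

/-- **Row (SW) on a junction with a pure arm and a mixed arm.** -/
theorem sw_sevEx : Sw sevEx 0 1 2 := by
  refine sw_of_mixedJunctionR (by decide) sevEx_junction ?_
  intro r
  fin_cases r <;> simp only [sevExP]
  · intro h2
    have := sevEx_compU_p1 h2
    simp at this
  · intro h2
    have := sevEx_compU_p2 h2
    simp at this

end MixedArms

end Summit.Ventures.PercRepro2
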